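import Mathlib
import Literature.NumberTheory.Transcendental.KZCalculus
import Literature.NumberTheory.Transcendental.KZProduct
import Literature.NumberTheory.Transcendental.GammaMonomialsDistribution

/-!
# Sketch — crux idea `schwarz-cusp-transport` for GammaHodgeSector (stmt-KontsevichZagierPeriods-3742)

First checkable statements of the line (they need not be proved here; they must elaborate).

* `TetrahedralCuspRelation` — the three-term cusp relation delivered by transporting the
  algebraic horizontal section of Schwarz's tetrahedral family ₂F₁(1/4, −1/12; 1/2; z) from z = 0
  to the cusp z = 1 (real blow-up of the corner (z,t) = (1,1)):
  (1−c)·B(a,c−a) + e·B_c·B(a,e) + A·b·B(c−a,1−e) = 0 with (a,b,c) = (1/4,−1/12,1/2), e = 1/3,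
  A = Γ(2−c)Γ(e)/(Γ(1−a)Γ(1−b)), B_c = Γ(2−c)Γ(−e)/(Γ(a−c+1)Γ(b−c+1)) (both real algebraic because
  the monodromy is finite), as ONE KZ relation among three Beta-shaped representations.
  Modulo three standard relations (duplication at 1/12 and 1/6, reflection at 1/3) the pair
  B(1/4,1/3) ~ alg·B(1/4,1/4) it yields is the Yamamoto–Das gap pair `DasGapTwelve`.
* `SchwarzCuspTransport` — the same for every Gauss triple (a,b,c) with finite monodromy
  (Beukers–Heckman interlacing for all units), 0 < a < c < 1, 0 < e = c−a−b < 1.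
-/

namespace Summit.KontsevichZagierPeriods.KontsevichZagierPeriods.Cruxes.GammaHodgeSector.SchwarzCuspTransport

open Literature.NumberTheory.Transcendental

/-- Tetrahedral cusp relation (a,b,c) = (1/4, −1/12, 1/2), e = 1/3, 1 − c = 1/2:
`[½·x^{-3/4}(1−x)^{-3/4}] + [e·B_c·x^{-3/4}(1−x)^{-2/3}] + [b·A·x^{-3/4}(1−x)^{-1/3}] ∈ relations`. -/
def TetrahedralCuspRelation : Prop :=
  ∀ (s₁ s₂ s₃ : KZ.IntegralRep 1),
    s₁.domain = {x | x 0 ∈ Set.Ioo (0:ℝ) 1} →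
    Set.EqOn s₁.integrand (fun x => (1 / 2 : ℝ) * (x 0) ^ (-(3:ℝ) / 4) * (1 - x 0) ^ (-(3:ℝ) / 4)) s₁.domain →
    s₂.domain = {x | x 0 ∈ Set.Ioo (0:ℝ) 1} →
    Set.EqOn s₂.integrand (fun x => ((1:ℝ) / 3) *
        (Real.Gamma (3 / 2) * Real.Gamma (-(1:ℝ) / 3) / (Real.Gamma (3 / 4) * Real.Gamma (5 / 12))) *
        (x 0) ^ (-(3:ℝ) / 4) * (1 - x 0) ^ (-(2:ℝ) / 3)) s₂.domain →
    s₃.domain = {x | x 0 ∈ Set.Ioo (0:ℝ) 1} →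
    Set.EqOn s₃.integrand (fun x => (-(1:ℝ) / 12) *
        (Real.Gamma (3 / 2) * Real.Gamma ((1:ℝ) / 3) / (Real.Gamma (3 / 4) * Real.Gamma (13 / 12))) *
        (x 0) ^ (-(3:ℝ) / 4) * (1 - x 0) ^ (-(1:ℝ) / 3)) s₃.domain →
    KZ.of s₁ + KZ.of s₂ + KZ.of s₃ ∈ KZ.relations

/-- General Schwarz cusp transport: for every irreducible Gauss triple with FINITE monodromy
(Beukers–Heckman: for every `u` coprime to the denominators, `{ua}` and `{ub}` are separated by
`{uc}`), with `0 < a < c < 1` and `0 < e := c − a − b < 1`, the three Beta-shaped representations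
`(1−c)·B(a,c−a)`, `e·B_c·B(a,e)`, `b·A·B(c−a,1−e)` sum to a KZ relation, where
`A = Γ(2−c)Γ(e)/(Γ(1−a)Γ(1−b))`, `B_c = Γ(2−c)Γ(−e)/(Γ(a−c+1)Γ(b−c+1))`. -/
def SchwarzCuspTransport : Prop :=
  ∀ (a b c : ℚ), 0 < a → a < c → c < 1 → 0 < c - a - b → c - a - b < 1 →
    (∀ n : ℤ, a ≠ n ∧ b ≠ n ∧ c - a ≠ n ∧ c - b ≠ n) →
    (∀ u : ℕ, 0 < u → Nat.Coprime u (Nat.lcm (Nat.lcm a.den b.den) c.den) →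
      ¬ (Int.fract ((u : ℚ) * a) < Int.fract ((u : ℚ) * c) ↔
         Int.fract ((u : ℚ) * b) < Int.fract ((u : ℚ) * c))) →
    ∀ (s₁ s₂ s₃ : KZ.IntegralRep 1),
      s₁.domain = {x | x 0 ∈ Set.Ioo (0:ℝ) 1} →
      Set.EqOn s₁.integrand
        (fun x => (1 - (c : ℝ)) * (x 0) ^ ((a : ℝ) - 1) * (1 - x 0) ^ ((c : ℝ) - a - 1)) s₁.domain →
      s₂.domain = {x | x 0 ∈ Set.Ioo (0:ℝ) 1} →
      Set.EqOn s₂.integrand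
        (fun x => ((c : ℝ) - a - b) *
          (Real.Gamma (2 - (c : ℝ)) * Real.Gamma (-((c : ℝ) - a - b)) /
            (Real.Gamma ((a : ℝ) - c + 1) * Real.Gamma ((b : ℝ) - c + 1))) *
          (x 0) ^ ((a : ℝ) - 1) * (1 - x 0) ^ ((c : ℝ) - a - b - 1)) s₂.domain →
      s₃.domain = {x | x 0 ∈ Set.Ioo (0:ℝ) 1} →
      Set.EqOn s₃.integrand
        (fun x => (b : ℝ) *
          (Real.Gamma (2 - (c : ℝ)) * Real.Gamma ((c : ℝ) - a - b) /
            (Real.Gamma (1 - (a : ℝ)) * Real.Gamma (1 - (b : ℝ)))) *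
          (x 0) ^ ((c : ℝ) - a - 1) * (1 - x 0) ^ (-((c : ℝ) - a - b))) s₃.domain →
      KZ.of s₁ + KZ.of s₂ + KZ.of s₃ ∈ KZ.relations

/-- The tetrahedral triple satisfies the hypotheses of the general schema (sanity of the
instance; the finite-monodromy clause is Beukers–Heckman interlacing at u ∈ {1,5,7,11}). -/
example : (0:ℚ) < 1/4 ∧ (1/4 : ℚ) < 1/2 ∧ (1/2 : ℚ) < 1 ∧
    (0:ℚ) < 1/2 - 1/4 - (-1/12) ∧ (1/2 : ℚ) - 1/4 - (-1/12) < 1 := by norm_num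


/-! ## Card 2 — `koblitz-ogus-halving` (root extraction closes the Yamamoto–Das gap, all levels)

The lattice input is PROVED in the tree:
`Literature.NumberTheory.Transcendental.KoblitzOgus.hodge_eq_combination_int`
(Hodge type ⇒ `n₀ • f ∈ span_ℤ(reflection, distribution)`); the ring input is the single
structural statement `RegularCancellation` (classes with non-zero value are non-zero-divisors in
`FormalRep ⧸ relations`), from which `PositiveRoot` (unique positive `n`-th roots, any `n`) follows
by the REAL factorisation `xⁿk − yⁿk = (x − y)·(xⁿ⁻¹ + xⁿ⁻²y + ⋯ + yⁿ⁻¹)·k` (the cofactor has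
positive value when `eval x, eval y > 0`). -/

/-- Regular cancellation: an element of non-zero value is a non-zero-divisor modulo the moves. -/
def RegularCancellation : Prop :=
  ∀ c d : KZ.FormalRep, c * d ∈ KZ.relations → KZ.eval d ≠ 0 → c ∈ KZ.relations

/-- Positive square roots are unique modulo the moves (the `n = 2` case the Yamamoto–Das gap needs;
`SelbergAMGM.PositiveCancellation` is the `n = 3` case). -/
def PositiveSquareRoot : Prop :=
  ∀ x y k : KZ.FormalRep, x * x * k - y * y * k ∈ KZ.relations →
    0 < KZ.eval x → 0 < KZ.eval y → KZ.eval k ≠ 0 → x - y ∈ KZ.relations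

/-- The glue of card 2 as a statement (to be proved from KZProductIdeal's ideal/commutativity
lemmas): regular cancellation gives unique positive square roots. -/
def HalvingGlue : Prop := RegularCancellation → PositiveSquareRoot

#check @Literature.NumberTheory.Transcendental.KoblitzOgus.hodge_eq_combination_int

end Summit.KontsevichZagierPeriods.KontsevichZagierPeriods.Cruxes.GammaHodgeSector.SchwarzCuspTransport
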